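import Literature.Computability.QuantumComplexity.QuadraticFourierSampler
import Literature.Computability.QuantumComplexity.ForrelationCircuitCode
import Literature.Computability.QuantumComplexity.CubicForrelation
import Literature.Computability.Complexity.PromiseBPPFromFPDecider
import Literature.Computability.Complexity.ListFoldChecks
import Literature.Computability.Complexity.StringEquality
import Literature.Computability.Complexity.CodeFPBudgets
import Literature.Computability.Complexity.CodeFPStrings
import HarnessLib

/-!
# The classical estimator of `Φ²` for cubic 2-fold Forrelation: the machine and its `P` witness

Topic `Literature/Computability/QuantumComplexity` (route `QuantumAdvantage/CubicForrelation`; the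
object requested by the refutation of crux `ExactCubicForrelationNotPrBPP` / the expected theorem
`CubicForrelationInPrBPP`: `cubicKForrelationProblem 2 ∈ PromiseBPP'`). Mathematics:
`ForrelationDerivativeTables.lean` (`2^{3n} Φ(f,g)² = Σ_{h,u} T_f(h,u) T_g(u,h)` with the derivative
Walsh tables `T_f(h,u) = Σ_x f(x) f(x⊕h) (-1)^{u·x}`; for `f = (-1)^a` with `a` CUBIC, `T_f(h,·)` is
the Walsh transform of the QUADRATIC derivative `D_h a`, an exact quadratic Gauss sum).

**The algorithm** (length-squared / Pauli-basis fidelity sampling; new-combination of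
Flammia–Liu 2011 direct fidelity estimation with the third-level structure of cubic phase states —
see the route file — formalised here as a deterministic polynomial-time function of
`⟨instance code, coin string⟩`, the shape required by `PromiseBPP'`, `Promise.lean`, through
`PromiseProblem.mem_PromiseBPP'_of_fp_decider`). On `⟨x, y⟩` with `x = encode (n, k, C₀, C₁)`:

0. reject unless `k = 2` and `n ≤ |x| + 1` (on the promise, instances with two or more idle input
   wires have `|Φ| ≤ 1/2`; this guard keeps `n = O(|x|)` although `n` is coded in binary);
1. `N = 128` rounds `r`, with fresh coin slices `h_r, w_r ∈ {0,1}ⁿ` of `y`: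
   `q₀ := D_{h_r} C₀` (as the oracle `v ↦ C₀(v) ⊕ C₀(v ⊕ h_r)`, `dq`), `u_r := uOf q₀ n w_r` (the exact
   Fourier sampler of `QuadraticFourierSampler.lean`: `u_r` is distributed `∝ T_{C₀}(h_r,u)²`),
   `Y_r := 8ⁿ · T_{C₁}(u_r, h_r) / T_{C₀}(h_r, u_r)` (two exact Gauss sums, `TOf`; an integer);
2. accept iff `(1/N) Σ_r Y_r / 8ⁿ ≥ 0.18`, i.e. `9 · N · 8ⁿ ≤ 50 · Σ_r Y_r`.

`E[Y/8ⁿ] = Φ²` and `E[(Y/8ⁿ)²] ≤ 1`, so Chebyshev separates `Φ ≥ 3/5` (`Φ² ≥ 0.36`) from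
`|Φ| ≤ 1/100` with error `≤ 1/(N · 0.17²) < 1/3` — that analysis is the sequel's; THIS file
constructs the machine:

* `accept : ForrCode.Inst → ℕ → List Bool → Bool` (the decision as a plain function of the mirror
  instance, the code length and the coins; `dq`, `coinVec`, `roundY`, `roundAt`, `sumY`, `nEff`);
* `accept_codeFP` — it is computed on `⟨KForrelationInstance.encode I, y⟩` in polynomial time
  (`CodeFP`, assembled from `ForrelationCircuitCode.lean`, `QuadraticFourierSampler.lean`,
  `F2RowReduction.lean`, `GaussCodeFP.lean` and the integer arithmetic of `CodeFPArith.lean`);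
* the total one-bit string function **`dec ∈ FP`** (`dec_mem_FP`, `oneBit_dec`) with
  **`dec ⟨encode I, y⟩ = [accept (instOf I) |encode I| y]`** (`dec_encode`), its language
  `decLang ∈ Classes.P` (`decLang_mem_P`), and the packaged membership criterion
  `mem_PromiseBPP'_of_accept` (acceptance-probability bounds for `accept` ⇒ `Q ∈ PromiseBPP'`).

## References

* S. Aaronson, A. Ambainis, *Forrelation*, SIAM J. Comput. 47 (2018), §1.1.3, §6. [AaronsonAmbainis2018]
* S. T. Flammia, Y.-K. Liu, *Direct fidelity estimation from few Pauli measurements*, PRL 106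
  (2011) 230501 (importance sampling of the Pauli expansion of a fidelity). [orientation]
* S. Bravyi, D. Gosset, PRL 116 (2016) 250501, App. A (quadratic Gauss sums). [BravyiGosset2016]
* O. Goldreich, *On promise problems*, 2006, Def. 1.2 (promise-BPP). [Goldreich2006]
* S. Arora, B. Barak, *Computational Complexity*, CUP 2009, §1.3, Def. 7.3. [AroraBarak2009]
-/

noncomputable section

namespace Literature.Computability.QuantumComplexity

namespace CubicDequant

open _root_.Computability Literature.Computability.Complexity Literature.Computability.Complexity.CodeFP
open Literature.Computability.Complexity.Brick
open ForrCode QuadSampler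
open Literature.Computability.Complexity.F2Elim (bxorL bitsE)

/-! ### The decision as a plain function -/

/-- The derivative oracle of a circuit (code) `c` in direction `h`: `v ↦ c(v) ⊕ c(v ⊕ h)`.
[cite: AaronsonAmbainis2018, §6] -/
def dq (c : PCirc) (h v : List Bool) : Bool := (evalP c v ^^ evalP c (bxorL v h))

/-- The number of rounds. [folklore] -/
def N : ℕ := 128

/-- The `n` coins starting at offset `off`. [folklore] -/
def coinVec (y : List Bool) (n off : ℕ) : List Bool := (List.range n).map fun i => y.getD (off + i) false

/-- **One round**: from the coin slices `h, w` the frequency `u = uOf (D_h c₀) n w` and the integer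
statistic `Y = 8ⁿ · T_{c₁}(u, h) / T_{c₀}(h, u)`. [cite: AaronsonAmbainis2018, §1.1.3] -/
def roundY (n : ℕ) (c₀ c₁ : PCirc) (h w : List Bool) : ℤ :=
  (8 : ℤ) ^ n * TOf (dq c₁ (uOf (dq c₀ h) n w)) n h / TOf (dq c₀ h) n (uOf (dq c₀ h) n w)

/-- Round `r` reads `h` at offset `2rn` and `w` at offset `(2r+1)n` of the coins. [folklore] -/
def roundAt (n : ℕ) (c₀ c₁ : PCirc) (y : List Bool) (r : ℕ) : ℤ :=
  roundY n c₀ c₁ (coinVec y n (2 * r * n)) (coinVec y n ((2 * r + 1) * n))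

/-- The sum of the `N` round statistics. [folklore] -/
def sumY (n : ℕ) (c₀ c₁ : PCirc) (y : List Bool) : ℤ := ((List.range N).map (roundAt n c₀ c₁ y)).sum

/-- The effective dimension `min n (L + 1)` (equal to `n` under the guard). [folklore] -/
def nEff (t : Inst) (L : ℕ) : ℕ := min t.1 (L + 1)

/-- **The decision** on the mirror instance `t = (n, k, circuits)`, the code length `L` and the
coins `y`: guard `k = 2 ∧ n ≤ L + 1`, then threshold `9 · N · 8ⁿ ≤ 50 · Σ_r Y_r` (mean `≥ 0.18`).
[cite: AaronsonAmbainis2018, §1.1.3] -/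
def accept (t : Inst) (L : ℕ) (y : List Bool) : Bool :=
  decide (t.2.1 = 2) && (decide (t.1 ≤ L + 1) &&
    decide (9 * (N : ℤ) * 8 ^ nEff t L ≤ 50 * sumY (nEff t L) (circAt t 0) (circAt t 1) y))

/-! ### Polynomial time -/

/-- The derivative oracle on codes: `((c, h), v) ↦ dq c h v`. [cite: AroraBarak2009, §1.3] -/
theorem dq_codeFP : CodeFP (pairE (pairE pcE bitsE) bitsE) bitE (fun t => dq t.1.1 t.1.2 t.2) := by
  have hc : CodeFP (pairE (pairE pcE bitsE) bitsE) pcE (fun t => t.1.1) := (fst _ _).fst'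
  have h1 : CodeFP (pairE (pairE pcE bitsE) bitsE) bitE (fun t => evalP t.1.1 t.2) :=
    evalP_codeFP.comp (hc.pair (bitsToStr.comp (snd _ _)))
  have h2 : CodeFP (pairE (pairE pcE bitsE) bitsE) bitE (fun t => evalP t.1.1 (bxorL t.2 t.1.2)) :=
    evalP_codeFP.comp (hc.pair (bitsToStr.comp (F2Elim.bxorL_codeFP.comp ((snd _ _).pair (fst _ _).snd'))))
  exact (h1.xor h2).congr fun _ => rfl

/-- The coin slices on codes: `(y, (n, off)) ↦ coinVec y n off` (`n` unary). [cite: AroraBarak2009, §1.3] -/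
theorem coinVec_codeFP : CodeFP (pairE strE (pairE unE natE)) bitsE (fun t => coinVec t.1 t.2.1 t.2.2) := by
  have hm := CodeFP.map (σ := List Bool × ℕ) (eσ := pairE strE natE) (eα := natE) (eβ := bitE)
    (g := fun t => t.1.1.getD (t.1.2 + t.2) false) (strGetDNat.comp ((fst _ _).fst'.pair (natAdd.comp ((fst _ _).snd'.pair (snd _ _)))))
  exact (hm.comp (((fst _ _).pair (snd _ _).snd').pair (urange.comp (snd _ _).fst'))).congr fun _ => rfl

/-- The code of the round context `((n, (c₀, c₁)), (h, w))`. [folklore] -/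
abbrev RE : (ℕ × (PCirc × PCirc)) × (List Bool × List Bool) → List Bool := pairE (pairE unE (pairE pcE pcE)) (pairE bitsE bitsE)

/-- **One round on codes**: `((n, (c₀, c₁)), (h, w)) ↦ roundY n c₀ c₁ h w`. [cite: AroraBarak2009, §1.3] -/
theorem roundY_codeFP : CodeFP RE intE (fun t => roundY t.1.1 t.1.2.1 t.1.2.2 t.2.1 t.2.2) := by
  have hn : CodeFP RE unE (fun t => t.1.1) := (fst _ _).fst'
  have hc0 : CodeFP RE pcE (fun t => t.1.2.1) := (fst _ _).snd'.fst'
  have hc1 : CodeFP RE pcE (fun t => t.1.2.2) := (fst _ _).snd'.snd'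
  have hh : CodeFP RE bitsE (fun t => t.2.1) := (snd _ _).fst'
  have hw : CodeFP RE bitsE (fun t => t.2.2) := (snd _ _).snd'
  -- the oracle family `Q (c, h) = dq c h`; no expected types (slow unification), `dsimp` at the end
  have hU := uOf_codeFP (σ := PCirc × List Bool) (eσ := pairE pcE bitsE) (Q := fun s => dq s.1 s.2) dq_codeFP
  have hT := TOf_codeFP (σ := PCirc × List Bool) (eσ := pairE pcE bitsE) (Q := fun s => dq s.1 s.2) dq_codeFP
  have hu := hU.comp (((hc0.pair hh).pair hn).pair hw)
  have htf := hT.comp (((hc0.pair hh).pair hn).pair hu)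
  have htg := hT.comp (((hc1.pair hu).pair hn).pair hh)
  have h8 := intPow.comp ((const RE (8 : ℤ)).pair hn)
  have hY := intEDiv.comp ((intMul.comp (h8.pair htg)).pair htf)
  refine hY.congr fun t => ?_
  dsimp only [roundY]

/-- The code of the sum context `((n, (c₀, c₁)), y)`. [folklore] -/
abbrev SE : (ℕ × (PCirc × PCirc)) × List Bool → List Bool := pairE (pairE unE (pairE pcE pcE)) strE

/-- One indexed round on codes: `(((n, (c₀, c₁)), y), r) ↦ roundAt n c₀ c₁ y r`. [cite: AroraBarak2009, §1.3] -/
theorem roundAt_codeFP : CodeFP (pairE SE natE) intE (fun t => roundAt t.1.1.1 t.1.1.2.1 t.1.1.2.2 t.1.2 t.2) := by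
  have hctx : CodeFP (pairE SE natE) (pairE unE (pairE pcE pcE)) (fun t => t.1.1) := (fst _ _).fst'
  have hy : CodeFP (pairE SE natE) strE (fun t => t.1.2) := (fst _ _).snd'
  have hnU : CodeFP (pairE SE natE) unE (fun t => t.1.1.1) := (fst _ _).fst'.fst'
  have hn : CodeFP (pairE SE natE) natE (fun t => t.1.1.1) := natOfUn.comp hnU
  have hr : CodeFP (pairE SE natE) natE (fun t => t.2) := snd _ _
  have h2rn : CodeFP (pairE SE natE) natE (fun t => 2 * t.2 * t.1.1.1) :=
    natMul.comp ((natMul.comp ((const _ 2).pair hr)).pair hn)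
  have h2r1n : CodeFP (pairE SE natE) natE (fun t => (2 * t.2 + 1) * t.1.1.1) :=
    natMul.comp ((natAdd.comp ((natMul.comp ((const _ 2).pair hr)).pair (const _ 1))).pair hn)
  have hh : CodeFP (pairE SE natE) bitsE (fun t => coinVec t.1.2 t.1.1.1 (2 * t.2 * t.1.1.1)) :=
    coinVec_codeFP.comp (hy.pair (hnU.pair h2rn))
  have hw : CodeFP (pairE SE natE) bitsE (fun t => coinVec t.1.2 t.1.1.1 ((2 * t.2 + 1) * t.1.1.1)) :=
    coinVec_codeFP.comp (hy.pair (hnU.pair h2r1n))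
  have hR := roundY_codeFP.comp (hctx.pair (hh.pair hw))
  refine hR.congr fun t => ?_
  dsimp only [roundAt]

/-- The sum of the rounds on codes: `((n, (c₀, c₁)), y) ↦ sumY n c₀ c₁ y`. [cite: AroraBarak2009, §1.3] -/
theorem sumY_codeFP : CodeFP SE intE (fun t => sumY t.1.1 t.1.2.1 t.1.2.2 t.2) := by
  have hm := CodeFP.map (σ := (ℕ × (PCirc × PCirc)) × List Bool) (eσ := SE) (eα := natE) (eβ := intE)
    (g := fun t => roundAt t.1.1.1 t.1.1.2.1 t.1.1.2.2 t.1.2 t.2) roundAt_codeFP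
  have hS := intSum.comp (hm.comp ((CodeFP.id _).pair (const _ (List.range N))))
  refine hS.congr fun t => ?_
  dsimp only [sumY]
  rfl

/-- The length of the instance code, in unary. [folklore] -/
theorem instLen_codeFP : CodeFP instE unE (fun t => (instE t).length) := of_fn onesFn onesFn_mem_FP fun _ => rfl

/-- **The decision on codes**: `(instance code, coins) ↦ accept t |code| y`. [cite: AroraBarak2009, §1.3] -/
theorem accept_codeFP : CodeFP (pairE instE strE) bitE (fun p => accept p.1 (instE p.1).length p.2) := by
  have ht : CodeFP (pairE instE strE) instE (fun p => p.1) := fst _ _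
  have hy : CodeFP (pairE instE strE) strE (fun p => p.2) := snd _ _
  have hL1 : CodeFP (pairE instE strE) unE (fun p => (instE p.1).length + 1) := unSucc.comp (instLen_codeFP.comp ht)
  have hn : CodeFP (pairE instE strE) natE (fun p => p.1.1) := instN_codeFP.comp ht
  have hk : CodeFP (pairE instE strE) bitE (fun p => decide (p.1.2.1 = 2)) := natEq.comp ((instK_codeFP.comp ht).pair (const _ 2))
  have hg : CodeFP (pairE instE strE) bitE (fun p => decide (p.1.1 ≤ (instE p.1).length + 1)) := natLeUn.comp (hn.pair hL1)
  have hne : CodeFP (pairE instE strE) unE (fun p => nEff p.1 (instE p.1).length) := (unOfNatMin.comp (hL1.pair hn)).congr fun _ => rfl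
  have hc : ∀ i : ℕ, CodeFP (pairE instE strE) pcE (fun p => circAt p.1 i) := fun i => circAt_codeFP.comp (ht.pair (const _ i))
  -- no expected types from here on (slow unification); `dsimp` at the end
  have hs := sumY_codeFP.comp ((hne.pair ((hc 0).pair (hc 1))).pair hy)
  have hlhs := intMul.comp ((const (pairE instE strE) (9 * (N : ℤ))).pair (intPow.comp ((const (pairE instE strE) (8 : ℤ)).pair hne)))
  have hrhs := intMul.comp ((const _ (50 : ℤ)).pair hs)
  have hall := hk.and (hg.and (intLe.comp (hlhs.pair hrhs)))
  refine hall.congr fun p => ?_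
  dsimp only [accept]

/-- **The decision on genuine instance codes**: `⟨encode I, y⟩ ↦ accept (instOf I) |encode I| y` is
computed in polynomial time. [cite: AroraBarak2009, §1.3] -/
theorem acceptI_codeFP : CodeFP (pairE KForrelationInstance.encode strE) bitE
    (fun p => accept (instOf p.1) p.1.encode.length p.2) := by
  have h := accept_codeFP.comp ((instOf_codeFP.comp (fst KForrelationInstance.encode strE)).pair (snd _ _))
  refine h.congr fun p => ?_
  dsimp only
  rw [encode_eq]

/-! ### The `FP` witness and the language in `P` -/

/-- A polynomial-time string function computing the decision on instance codes (from
`acceptI_codeFP`, by choice). [cite: AroraBarak2009, §1.3] -/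
def accF : List Bool → List Bool := Classical.choose acceptI_codeFP

/-- `accF ∈ FP`. [cite: AroraBarak2009, §1.3] -/
theorem accF_mem_FP : accF ∈ FP := (Classical.choose_spec acceptI_codeFP).1

/-- `accF` on instance codes. [cite: AroraBarak2009, §1.3] -/
theorem accF_encode (I : KForrelationInstance) (y : List Bool) :
    accF (boolPair I.encode y) = [accept (instOf I) I.encode.length y] :=
  (Classical.choose_spec acceptI_codeFP).2 (I, y)

/-- **The decider**: `accF` normalised to one bit on every string (`[accF z = [true]]`).
[cite: Goldreich2006, Def. 1.2] -/
def dec : List Bool → List Bool := eqPairFn ∘ fanoutFn accF (fun _ => [true])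

/-- **`dec ∈ FP`.** [cite: AroraBarak2009, §1.3] -/
theorem dec_mem_FP : dec ∈ FP :=
  comp_mem_FP eqPairFn_mem_FP (fanoutFn_mem_FP accF_mem_FP (const_mem_FP _))

/-- `dec` is one-bit on every string. [folklore] -/
theorem oneBit_dec : OneBit dec := OneBit.comp oneBit_eqPairFn _

/-- `dec` tests `accF z = [true]`. [folklore] -/
theorem dec_apply (z : List Bool) : dec z = [decide (accF z = [true])] := by
  rw [dec, Function.comp_apply, fanoutFn_apply, eqPairFn_boolPair]

/-- **The decider on instance codes**: `dec ⟨encode I, y⟩ = [accept (instOf I) |encode I| y]`.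
[cite: AaronsonAmbainis2018, §1.1.3] -/
theorem dec_encode (I : KForrelationInstance) (y : List Bool) :
    dec (boolPair I.encode y) = [accept (instOf I) I.encode.length y] := by
  rw [dec_apply, accF_encode]
  cases accept (instOf I) I.encode.length y <;> rfl

/-- The language of the decider, `{z | dec z = [true]}`. [cite: Goldreich2006, Def. 1.2] -/
def decLang : Language Bool := decLangOf dec

/-- **`decLang ∈ P`.** [cite: AroraBarak2009, Def. 1.13] -/
theorem decLang_mem_P : decLang ∈ Classes.P := decLangOf_mem_P dec_mem_FP oneBit_dec

/-- Membership of instance/coin pairs in the language. [folklore] -/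
theorem boolPair_mem_decLang_iff (I : KForrelationInstance) (y : List Bool) :
    boolPair I.encode y ∈ decLang ↔ accept (instOf I) I.encode.length y = true := by
  show dec (boolPair I.encode y) = [true] ↔ _
  rw [dec_encode]
  cases accept (instOf I) I.encode.length y <;> simp

/-- **Promise-`BPP` membership from acceptance bounds of the estimator**: for a promise problem whose
instances are Forrelation instance codes, if for some polynomial `p` the estimator accepts a
`≥ 2/3` fraction of the coin strings of length `p |x|` on yes-instances and rejects a `≥ 2/3`
fraction on no-instances, then the problem is in `PromiseBPP'` (witness `decLang ∈ P`).
[cite: Goldreich2006, Def. 1.2] -/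
theorem mem_PromiseBPP'_of_accept (Q : PromiseProblem) (p : Polynomial ℕ)
    (hyes : ∀ I : KForrelationInstance, I.encode ∈ Q.yes →
      (2 / 3 : ℝ) ≤ uniformProb (p.eval I.encode.length) {y | accept (instOf I) I.encode.length y = true})
    (hno : ∀ I : KForrelationInstance, I.encode ∈ Q.no →
      (2 / 3 : ℝ) ≤ uniformProb (p.eval I.encode.length) {y | accept (instOf I) I.encode.length y = false})
    (hY : ∀ x ∈ Q.yes, ∃ I : KForrelationInstance, I.encode = x) (hN : ∀ x ∈ Q.no, ∃ I : KForrelationInstance, I.encode = x) :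
    Q ∈ PromiseBPP' := by
  refine Q.mem_PromiseBPP'_of_fp_decider dec_mem_FP oneBit_dec p (fun x hx => ?_) (fun x hx => ?_)
  · obtain ⟨I, rfl⟩ := hY x hx
    refine (hyes I hx).trans_eq (congrArg _ (Set.ext fun y => ?_))
    show accept (instOf I) I.encode.length y = true ↔ dec (boolPair I.encode y) = [true]
    rw [dec_encode]; cases accept (instOf I) I.encode.length y <;> simp
  · obtain ⟨I, rfl⟩ := hN x hx
    refine (hno I hx).trans_eq (congrArg _ (Set.ext fun y => ?_))
    show accept (instOf I) I.encode.length y = false ↔ dec (boolPair I.encode y) = [false]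
    rw [dec_encode]; cases accept (instOf I) I.encode.length y <;> simp

/-- The yes-instances of the cubic Forrelation problems are instance codes. [folklore] -/
theorem cubic_yes_codes (k₀ : ℕ) : ∀ x ∈ (cubicKForrelationProblem k₀).yes, ∃ I : KForrelationInstance, I.encode = x := by
  rintro x ⟨I, -, rfl⟩; exact ⟨I, rfl⟩

/-- The no-instances of the cubic Forrelation problems are instance codes. [folklore] -/
theorem cubic_no_codes (k₀ : ℕ) : ∀ x ∈ (cubicKForrelationProblem k₀).no, ∃ I : KForrelationInstance, I.encode = x := by
  rintro x ⟨I, -, rfl⟩; exact ⟨I, rfl⟩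

/-- **Reduction of `CubicForrelationInPrBPP` to two acceptance bounds of the estimator.** The item
`cubicKForrelationProblem 2 ∈ PromiseBPP'` follows from: on yes-instances (`Φ ≥ 3/5`) the estimator
accepts `≥ 2/3` of the coin strings of length `p |x|`, on no-instances (`|Φ| ≤ 1/100`) it rejects
`≥ 2/3` of them. [cite: AaronsonAmbainis2018, §1.1.3] -/
theorem cubic_two_mem_PromiseBPP'_of_bounds (p : Polynomial ℕ)
    (hyes : ∀ I : KForrelationInstance, I.encode ∈ (cubicKForrelationProblem 2).yes →
      (2 / 3 : ℝ) ≤ uniformProb (p.eval I.encode.length) {y | accept (instOf I) I.encode.length y = true})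
    (hno : ∀ I : KForrelationInstance, I.encode ∈ (cubicKForrelationProblem 2).no →
      (2 / 3 : ℝ) ≤ uniformProb (p.eval I.encode.length) {y | accept (instOf I) I.encode.length y = false}) :
    cubicKForrelationProblem 2 ∈ PromiseBPP' :=
  mem_PromiseBPP'_of_accept _ p hyes hno (cubic_yes_codes 2) (cubic_no_codes 2)

end CubicDequant

end Literature.Computability.QuantumComplexity

end
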